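import Summits.ResolutionOfSingularities.ResolutionOfSingularities.Theorems.MarkedTransferCampaignW46ThreefoldsGammaFreeGlobalEtale
import Literature.AlgebraicGeometry.Resolution.KollarStep2Stage
import Literature.AlgebraicGeometry.Resolution.ControlledTransformBaseChange
import HarnessLib

/-!
# [OURS · L1 W4.6 rung (ii)] POWER HOMOGENEITY OF Γ-FREE ORDER REDUCIBILITY — `(I, m)` and `(I^k, k·m)` have the SAME
# sequences of permissible blowing-ups; `OrderReducible I m ↔ OrderReducible (I ^ k) (k * m)` (`k ≥ 1`), PROVED

Cell res-hironaka, LADDER-RESOLUTION rung L (D-0089), slot W4.6, rung (ii) (threefold hypersurfaces) in the DIMENSION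
LADDER of the Γ-free global order-reduction statement (typer res-L1-type-o1: `…ThreefoldsGammaFreeGlobal.lean` p493059
`IsPermissibleBlowupSeq`; `…ThreefoldsGammaFreeGlobalLadder.lean` p496755 `OrderReducible I m`). Seat res-L1-s46-pv-3
(gen 3). Host route MarkedTransfer, host item `HypersurfaceOrderReductionDimLeThree` (stmt-ResolutionOfSingularities-16156);
filed `--kind proof --supports` it `--as helper`. Everything here is OURS: kernel theorems over the campaign definitions
and PROVED tree lemmas; NOTHING is a statement of Hironaka's manuscript; no typed `Hironaka2017` candidate enters; no named
FACT is a hypothesis. AI-written; AI review is weaker than expert review.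

## What is proved (no new definitions)

On a regular locally Noetherian scheme `X` (all stages of a sequence of permissible blowing-ups are then regular and
locally Noetherian, `IsPermissibleBlowupSeq.isLocallyNoetherian_and_isRegular`), for `k ≥ 1`:

* `CampaignW46.IsPermissibleBlowupSeq.pow` — **a sequence of permissible blowing-ups for `(J, b)` with last transform
  `J′` IS a sequence of permissible blowing-ups for `(J^k, k·b)` with last transform `J′^k`** (same stages, same
  centres): at a regular point `ord_y(J^k) ≥ k·b ↔ ord_y(J) ≥ b` (tree `le_idealOrder_pow_iff`, BGMW Example 3.4.2), and
  the controlled transform of `J^k` with exponent `k·b` is the `k`-th power of that of `J` with exponent `b` (transform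
  law `𝓘_E^b · J′ = π^*J` for a permissible centre, tree `pow_mul_controlledTransform_eq_of_forall_le_idealOrder`; hence
  `π^*(J^k) = 𝓘_E^{kb} · J′^k`, and `(π^*(J^k) : 𝓘_E^{kb}) = J′^k` by Cartier cancellation, tree `colon_pow_eq_of_mul_eq`).
* `CampaignW46.IsPermissibleBlowupSeq.of_pow` — **conversely**, every sequence of permissible blowing-ups for
  `(J^k, k·b)` is one for `(J, b)`, with last transform `J′` satisfying `(last transform for J^k) = J′^k`.
* `CampaignW46.OrderReducible.pow` / `.of_pow` / `CampaignW46.orderReducible_pow_iff` — **`OrderReducible I m ↔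
  OrderReducible (I ^ k) (k * m)`** (`ord_x(J′^k) = k · ord_x(J′)` at regular points, tree `idealOrder_pow_eq`).

HONEST VALUE. A structural reduction, not a rung: the Γ-free statement for a NON-REDUCED hypersurface `f^k` with marking
`k·m₀` is EQUIVALENT to the statement for `(f, m₀)` — e.g. `((x₂)², 2)` (the regime-(ii) witness) reduces to
`((x₂), 1)`; combined with the other slices it removes pure multiplicities from the open part of rung (ii). Markings not
divisible by the multiplicity are untouched (BGMW Example 3.4.2 is the equality of SUPPORTS `supp(𝓘^e, eμ) = supp(𝓘, μ)`;
here it is promoted to whole sequences and to the conclusion `ord < m`).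

References: `…ThreefoldsGammaFreeGlobal.lean` (p493059), `…ThreefoldsGammaFreeGlobalLadder.lean` (p496755),
`…ThreefoldsGammaFreeGlobalEtale.lean` (p500660: `IsPermissibleBlowupSeq.isLocallyNoetherian`); tree
`Resolution/KollarStep2Stage.lean` (`idealOrder_pow_eq`, `le_idealOrder_pow_iff` [ZariskiSamuel1960, VIII §1 Thm. 1]
[BierstoneGrigorievMilmanWlodarczyk2011, Example 3.4.2]), `Hironaka2017/PermissibleLSB.lean`
(`pow_mul_controlledTransform_eq_of_forall_le_idealOrder` [CossartPiltant2008, proof of Prop. 4.2]),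
`Resolution/ControlledTransformBaseChange.lean` (`colon_pow_eq_of_mul_eq`), `Resolution/MarkedIdealsLemmas.lean`
(`comap_pow`, `stalkIdeal_pow`). H. Hironaka, ms. 2017-03-23, Def. 2.4 p.6 — scope only, under adjudication, not cited as
fact. [Hironaka2017]
-/

noncomputable section

set_option linter.dupNamespace false -- mandated namespace of this single-conjunct summit

open CategoryTheory AlgebraicGeometry TopologicalSpace IsLocalRing

namespace Summit.ResolutionOfSingularities.ResolutionOfSingularities.Theorems

namespace CampaignW46

open Literature.AlgebraicGeometry.Resolution
open Literature.AlgebraicGeometry.Hironaka2017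
open Scheme.IdealSheafData

universe u

variable {X : Scheme.{u}} [IsLocallyNoetherian X]

/-! ## §1 One step: the controlled transform of a power -/

/-- **The controlled transform of `J^k` with exponent `k·b` along a blowing up with regular centre inside the
order-`≥ b` locus of `J` is the `k`-th power of the controlled transform of `J` with exponent `b`** (regular locally
Noetherian source and target): `π^*J = 𝓘_E^b · J′` (transform law), so `π^*(J^k) = 𝓘_E^{kb} · J′^k`, and the exceptional
ideal is effective Cartier. [cite: CossartPiltant2008, proof of Prop. 4.2] -/
theorem controlledTransform_pow_eq {X' : Scheme.{u}} [IsLocallyNoetherian X'] (hX : Scheme.IsRegular X)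
    {D : Closeds X} {π : X' ⟶ X} (hreg : Scheme.IsRegular (vanishingIdeal D).subscheme)
    (hπ : IsBlowup π (vanishingIdeal D)) {J : X.IdealSheafData} {b : ℕ}
    (hD : ∀ y ∈ (D : Set X), (b : ℕ∞) ≤ idealOrder J y) (k : ℕ) :
    controlledTransform π (vanishingIdeal D) (J ^ k) (k * b) = (controlledTransform π (vanishingIdeal D) J b) ^ k := by
  have hlaw := pow_mul_controlledTransform_eq_of_forall_le_idealOrder hX hreg hπ hD
  refine colon_pow_eq_of_mul_eq hπ.isEffectiveCartier ?_
  rw [comap_pow, ← hlaw, mul_pow, ← pow_mul, mul_comm b k]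

omit [IsLocallyNoetherian X] in
/-- At any point, `k·b ≤ ord (J^k)` as soon as `b ≤ ord J` (any `k`; `J_x ⊆ 𝔪^b ⇒ J_x^k ⊆ 𝔪^{kb}`).
[cite: BierstoneGrigorievMilmanWlodarczyk2011, Example 3.4.2] -/
theorem le_idealOrder_pow_of_le {x : X} (J : X.IdealSheafData) {b : ℕ} (h : (b : ℕ∞) ≤ idealOrder J x) (k : ℕ) :
    ((k * b : ℕ) : ℕ∞) ≤ idealOrder (J ^ k) x := by
  rw [le_idealOrder_iff, stalkIdeal_pow, mul_comm, pow_mul]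
  exact Ideal.pow_right_mono ((le_idealOrder_iff J x b).mp h) k

/-! ## §2 Whole sequences -/

namespace IsPermissibleBlowupSeq

variable {J : X.IdealSheafData} {b : ℕ}

/-- **POWERS: a sequence of permissible blowing-ups for `(J, b)` is one for `(J^k, k·b)`, with last transform the `k`-th
power** (regular locally Noetherian `X`; same stages, same centres, same blow-ups).
[cite: BierstoneGrigorievMilmanWlodarczyk2011, Example 3.4.2] -/
theorem pow (hX : Scheme.IsRegular X) (k : ℕ) :
    ∀ {Z : Scheme.{u}} {σ : Z ⟶ X} {J' : Z.IdealSheafData}, IsPermissibleBlowupSeq J b σ J' →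
      IsPermissibleBlowupSeq (J ^ k) (k * b) σ (J' ^ k) := by
  intro Z σ J' h
  induction h with
  | nil => exact IsPermissibleBlowupSeq.nil
  | @blowup Z₁ Z₀ σ₀ J₀ h₀ D π hreg hD hπ ih =>
    obtain ⟨hN₀, hR₀⟩ := h₀.isLocallyNoetherian_and_isRegular inferInstance hX
    haveI := hN₀
    haveI : IsLocallyNoetherian Z₁ := (h₀.blowup D π hreg hD hπ).isLocallyNoetherian inferInstance
    have hD' : ∀ y ∈ (D : Set Z₀), ((k * b : ℕ) : ℕ∞) ≤ idealOrder (J₀ ^ k) y := fun y hy =>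
      le_idealOrder_pow_of_le J₀ (hD y hy) k
    have step := ih.blowup D π hreg hD' hπ
    rwa [controlledTransform_pow_eq hR₀ hreg hπ hD k] at step

/-- **CONVERSELY: a sequence of permissible blowing-ups for `(J^k, k·b)`, `k ≥ 1`, is one for `(J, b)`**, and its last
transform is the `k`-th power of the corresponding transform of `J` (regular locally Noetherian `X`).
[cite: BierstoneGrigorievMilmanWlodarczyk2011, Example 3.4.2] -/
theorem of_pow (hX : Scheme.IsRegular X) {k : ℕ} (hk : 0 < k) :
    ∀ {Z : Scheme.{u}} {σ : Z ⟶ X} {K' : Z.IdealSheafData}, IsPermissibleBlowupSeq (J ^ k) (k * b) σ K' →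
      ∃ J' : Z.IdealSheafData, IsPermissibleBlowupSeq J b σ J' ∧ K' = J' ^ k := by
  intro Z σ K' h
  -- generalise the power to run the induction on the sequence
  suffices H : ∀ {K : X.IdealSheafData} {c : ℕ} {Z : Scheme.{u}} {σ : Z ⟶ X} {K' : Z.IdealSheafData},
      IsPermissibleBlowupSeq K c σ K' → K = J ^ k → c = k * b →
        ∃ J' : Z.IdealSheafData, IsPermissibleBlowupSeq J b σ J' ∧ K' = J' ^ k from H h rfl rfl
  intro K c Z σ K' h
  induction h with
  | nil =>
    rintro rfl rfl
    exact ⟨J, IsPermissibleBlowupSeq.nil, rfl⟩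
  | @blowup Z₁ Z₀ σ₀ K₀ h₀ D π hreg hD hπ ih =>
    rintro rfl rfl
    obtain ⟨J₀, hJ₀, rfl⟩ := ih rfl rfl
    obtain ⟨hN₀, hR₀⟩ := hJ₀.isLocallyNoetherian_and_isRegular inferInstance hX
    haveI := hN₀
    -- at regular points `k·b ≤ ord (J₀^k) ↔ b ≤ ord J₀`
    have hD' : ∀ y ∈ (D : Set Z₀), (b : ℕ∞) ≤ idealOrder J₀ y := by
      intro y hy
      haveI := hR₀ y
      exact (le_idealOrder_pow_iff J₀ hk b).mp (hD y hy)
    haveI : IsLocallyNoetherian Z₁ := (hJ₀.blowup D π hreg hD' hπ).isLocallyNoetherian inferInstance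
    exact ⟨_, hJ₀.blowup D π hreg hD' hπ, controlledTransform_pow_eq hR₀ hreg hπ hD' k⟩

end IsPermissibleBlowupSeq

/-! ## §3 Order-reducibility of powers -/

namespace OrderReducible

variable {I : X.IdealSheafData} {m : ℕ}

/-- **`OrderReducible I m → OrderReducible (I ^ k) (k * m)`** for `k ≥ 1` on a regular locally Noetherian `X`: the same
sequence works, and at the (regular) points of the last stage `ord (J′^k) = k · ord J′ < k · m`.
[cite: BierstoneGrigorievMilmanWlodarczyk2011, Example 3.4.2] -/
theorem pow (hX : Scheme.IsRegular X) (h : OrderReducible I m) {k : ℕ} (hk : 0 < k) :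
    OrderReducible (I ^ k) (k * m) := by
  obtain ⟨Z, σ, J', hseq, hlt⟩ := h
  obtain ⟨hN, hR⟩ := hseq.isLocallyNoetherian_and_isRegular inferInstance hX
  refine ⟨Z, σ, J' ^ k, hseq.pow hX k, fun x => ?_⟩
  haveI := hR x
  have hfin : idealOrder J' x ≠ ⊤ := ne_top_of_lt (hlt x)
  obtain ⟨a, ha⟩ := ENat.ne_top_iff_exists.mp hfin
  rw [idealOrder_pow_eq J' ha.symm k]
  have ha' : a < m := by
    have := hlt x
    rw [← ha] at this
    exact_mod_cast this
  exact_mod_cast Nat.mul_lt_mul_of_pos_left ha' hk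

/-- **`OrderReducible (I ^ k) (k * m) → OrderReducible I m`** for `k ≥ 1` on a regular locally Noetherian `X`.
[cite: BierstoneGrigorievMilmanWlodarczyk2011, Example 3.4.2] -/
theorem of_pow (hX : Scheme.IsRegular X) {k : ℕ} (hk : 0 < k) (h : OrderReducible (I ^ k) (k * m)) :
    OrderReducible I m := by
  obtain ⟨Z, σ, K', hseq, hlt⟩ := h
  obtain ⟨J', hJ', rfl⟩ := IsPermissibleBlowupSeq.of_pow hX hk hseq
  obtain ⟨hN, hR⟩ := hJ'.isLocallyNoetherian_and_isRegular inferInstance hX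
  refine ⟨Z, σ, J', hJ', fun x => ?_⟩
  haveI := hR x
  by_contra hge
  rw [not_lt] at hge
  have h1 : ((k * m : ℕ) : ℕ∞) ≤ idealOrder (J' ^ k) x := (le_idealOrder_pow_iff J' hk m).mpr hge
  exact absurd (hlt x) (not_lt.mpr (by exact_mod_cast h1))

end OrderReducible

/-- **POWER HOMOGENEITY**: `OrderReducible I m ↔ OrderReducible (I ^ k) (k * m)` for `k ≥ 1` on a regular locally
Noetherian scheme. [cite: BierstoneGrigorievMilmanWlodarczyk2011, Example 3.4.2] -/
theorem orderReducible_pow_iff (hX : Scheme.IsRegular X) {I : X.IdealSheafData} {m k : ℕ} (hk : 0 < k) :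
    OrderReducible (I ^ k) (k * m) ↔ OrderReducible I m :=
  ⟨OrderReducible.of_pow hX hk, fun h => h.pow hX hk⟩

end CampaignW46

end Summit.ResolutionOfSingularities.ResolutionOfSingularities.Theorems

end
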